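import Literature.MathematicalPhysics.QuantumFieldTheory.Sweep1ChatterjeeFreeEnergyProofs
import Literature.MathematicalPhysics.QuantumLattice.RepLieAlgebra
import Summits.QuantumFields.YangMills.Theses.EquipartitionCriticality
import Summits.QuantumFields.YangMills.Theorems.EquipartitionCriticalityFreeEnergyLogCoefficientDefs
import Summits.QuantumFields.YangMills.Theorems.EquipartitionCriticalityFreeEnergyLogCoefficientStubTransfer
import Summits.QuantumFields.YangMills.Theorems.EquipartitionCriticalityFreeEnergyLogCoefficientStubFourProduct
import Summits.QuantumFields.YangMills.Theorems.EquipartitionCriticalityFreeEnergyLogCoefficientStubWeakCoupling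
import Summits.QuantumFields.YangMills.Theorems.EquipartitionCriticalityFreeEnergyLogCoefficientStubChartAction
import Summits.QuantumFields.YangMills.Theorems.EquipartitionCriticalityFreeEnergyLogCoefficientStubLogBounds
import Summits.QuantumFields.YangMills.Theorems.EquipartitionCriticalityFreeEnergyLogCoefficientStubAbstractJointLimit
import Summits.QuantumFields.YangMills.Theorems.EquipartitionCriticalityFreeEnergyLogCoefficientStubExpChartPackage
import HarnessLib

/-!
# `FreeEnergyLogCoefficient` (crux `stmt-QuantumFields-8759`) — the crux proof (line `Sketch`)

Route `EquipartitionCriticality`, crux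
`Summit.QuantumFields.YangMills.Theses.EquipartitionCriticality.FreeEnergyLogCoefficient`:
`∀ G` compact simple Lie, `∀ r : LatticeRep G`, `∃ K`, `f_r(β) + (3 D/2) log β → K` with
`D = finrank(span{X | ∀ t, exp(tX) ∈ range r.ρ})`.

LINE (port of the tree's mechanised `U(N)` proof of Chatterjee's Theorem 2.1,
`chatterjee_freeEnergy_holds`, to `r(G) ≤ U(N)` via the exponential chart with a soft Haar constant):
the seven stubs `stub_*` are proved in the imported sibling files; this file is the composition
`FreeEnergyLogCoefficient_of` (and the canonical alias `freeEnergyLogCoefficient_proof`).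
-/

noncomputable section


/-! ## The stubs of line `Sketch`

All seven registered stubs (`stub_abstractJointLimit`, `stub_expChartPackage`, `stub_fourProduct`,
`stub_weakCoupling`, `stub_chartAction`, `stub_logBounds`, `stub_transfer`) are proved in the imported
sibling files `EquipartitionCriticalityFreeEnergyLogCoefficientStub*.lean`. -/

/-! ## Composition: the stubs close the crux -/

namespace Summit.QuantumFields.YangMills.Theorems.FreeEnergyLogCoefficient

open scoped Matrix Matrix.Norms.Frobenius ENNReal NNReal
open MeasureTheory Measure Filter Topology Set
open Literature.Probability.LatticeModels Literature.MathematicalPhysics.QuantumLattice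
open Literature.MathematicalPhysics.QuantumFieldTheory

section Compose

variable {d N : ℕ} {G : Type*} [Group G] [TopologicalSpace G] [IsTopologicalGroup G]
  [CompactSpace G] [MeasurableSpace G] [BorelSpace G] (ρ : G →* Matrix (Fin N) (Fin N) ℂ)

omit [TopologicalSpace G] [IsTopologicalGroup G] [CompactSpace G] [MeasurableSpace G] [BorelSpace G] in
/-- `Re tr ρ(g) ≤ N` for a unitary-valued representation. [folklore] -/
theorem re_trace_le_of_unitary (hU : ∀ g, ρ g ∈ Matrix.unitaryGroup (Fin N) ℂ) (g : G) :
    ((ρ g).trace).re ≤ N :=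
  ChatterjeeJointLimit.re_trace_le ⟨ρ g, hU g⟩

omit [TopologicalSpace G] [IsTopologicalGroup G] [CompactSpace G] [MeasurableSpace G] [BorelSpace G] in
/-- `|Re tr ρ(g)| ≤ N` for a unitary-valued representation. [folklore] -/
theorem abs_re_trace_le_of_unitary (hU : ∀ g, ρ g ∈ Matrix.unitaryGroup (Fin N) ℂ) (g : G) :
    |((ρ g).trace).re| ≤ N :=
  ChatterjeeJointLimit.abs_re_trace_le_card ⟨ρ g, hU g⟩

variable [SecondCountableTopology G]

/-- The cube partition function is antitone in the cube (weights `≤ 1`), for any continuous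
unitary-valued representation (`ChatterjeeJointLimit.Z_anti` for `U(N)`). [cite: arXiv160201222, Lemma 17.3 (proof)] -/
theorem zdPartitionFunction_anti (hρ : Continuous ρ) (hU : ∀ g, ρ g ∈ Matrix.unitaryGroup (Fin N) ℂ)
    {β : ℝ} (hβ : 0 ≤ β) {n n' : ℕ} (h : n ≤ n') :
    zdPartitionFunction ρ β (halfOpenBox d n') ≤ zdPartitionFunction ρ β (halfOpenBox d n) := by
  rw [ChatterjeeFreeEnergy.zdPartitionFunction_eq_ofReal ρ hρ β,
    ChatterjeeFreeEnergy.zdPartitionFunction_eq_ofReal ρ hρ β]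
  refine ENNReal.ofReal_le_ofReal (integral_mono ?_ ?_ fun U => ?_)
  · exact AreaLaw.integrable_zdHaar_of_continuous (ChatterjeeFreeEnergy.continuous_labelWeight ρ hρ β _)
  · exact AreaLaw.integrable_zdHaar_of_continuous (ChatterjeeFreeEnergy.continuous_labelWeight ρ hρ β _)
  · exact ChatterjeeFreeEnergy.prod_labelWeight_le_of_subset ρ (re_trace_le_of_unitary ρ hU) hβ
      (ChatterjeeJointLimit.plaquettesIn_mono' (ChatterjeeJointLimit.halfOpenBox_mono' h)) U

/-- `Z(B_n, β).toReal > 0`. [folklore] -/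
theorem zdPartitionFunction_toReal_pos (hρ : Continuous ρ) (β : ℝ) (n : ℕ) :
    0 < (zdPartitionFunction ρ β (halfOpenBox d n)).toReal := by
  rw [ChatterjeeFreeEnergy.zdPartitionFunction_toReal_eq ρ hρ β n]
  exact FreeEnergy.zdZ_pos ρ hρ β _

/-- **The one-box interface of a faithful unitary representation in the exponential chart.** From the
chart package (stub 2), the four-product bound (stub 3), the a-priori bounds (stub 4), the Gaussian
sandwich (stub 5) and its logarithmic form (stub 6), together with the generic scale comparisons of
the tree (Lemmas 17.3, 17.5: `ChatterjeeFreeEnergy.log_Z_mul_le`, `le_log_Z_mul`), the free-boundary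
cube partition functions of `ρ` satisfy `OneBoxBounds d` with `D = dimE ρ`. [cite: arXiv160201222, §17] -/
theorem exists_oneBoxBounds (hd : 1 ≤ d) (hρ : Continuous ρ) (hinj : Function.Injective ρ)
    (hU : ∀ g, ρ g ∈ Matrix.unitaryGroup (Fin N) ℂ) :
    ∃ B : OneBoxBounds d,
      B.logZ = (fun n β => Real.log (zdPartitionFunction ρ β (halfOpenBox d n)).toReal) ∧
      B.D = dimE ρ := by
  obtain ⟨hcont, hψ, hskew, -, cH, r₁, C₁, hcH, hr₁, hr₁2, hC₁, hκ, hball, hincl, hup, hlow⟩ :=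
    stub_expChartPackage ρ hρ hinj hU
  obtain ⟨A₀, hA₀, h4⟩ := stub_fourProduct
  obtain ⟨hZ1, C, hC, h71, h101⟩ := stub_weakCoupling (d := d) ρ hρ hU hC₁ hball
  have hchart := stub_chartAction (d := d) hd ρ hρ hU (lieIso ρ) hskew (expChart ρ) hcont.measurable hψ
    hA₀ (fun Y₁ Y₂ Y₃ Y₄ => h4 Y₁ Y₂ Y₃ Y₄) hC h101 hcH (hr₁2.trans (by norm_num)) (κ := κE)
    (fun r hr0 hr => ⟨(hκ r hr0 hr).1, (hκ r hr0 hr).2.1⟩) hincl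
    (fun n r hr hr' F hF => hup (WilsonWeakCoupling.FreeIdx d n) r hr hr' F hF)
    (fun n r hr hr' F hF => hlow (WilsonWeakCoupling.FreeIdx d n) r hr hr' F hF)
  have hA : 0 ≤ A₀ * N := by positivity
  obtain ⟨hupper, hlower⟩ := stub_logBounds (d := d) hd ρ hρ (D := dimE ρ) hA hC hcH (κ := κE)
    (fun r hr0 hr => (hκ r hr0 hr).1) hZ1 h71 hchart.1 hchart.2
  have hρN := re_trace_le_of_unitary ρ hU
  have hM := abs_re_trace_le_of_unitary ρ hU
  refine ⟨{ logZ := fun n β => Real.log (zdPartitionFunction ρ β (halfOpenBox d n)).toReal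
            D := dimE ρ
            ν := max (dimE ρ : ℝ) 1
            cH := cH
            C71 := C
            A := A₀ * N
            P₅ := (N : ℝ) + N
            r₁ := r₁
            κ := κE
            Kκ := 16
            one_le_ν := le_max_right _ _
            cH_pos := hcH
            C71_pos := hC
            A_nonneg := hA
            P₅_nonneg := by positivity
            r₁_pos := hr₁
            r₁_le := hr₁2
            Kκ_nonneg := by norm_num
            one_le_κ := fun r hr0 hr => (hκ r hr0 hr).1
            log_κ_le := fun r hr0 hr => (hκ r hr0 hr).2.2
            logZ_nonpos := fun n β hβ => ?_
            logZ_anti := fun β hβ n n' hnn' => ?_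
            thm71 := fun n β hβ => ?_
            mul_le := fun β hβ m k => ChatterjeeFreeEnergy.log_Z_mul_le (d := d) ρ hρ hρN hβ m k
            le_mul := fun β hβ n k => ?_
            upper := hupper
            lower := hlower }, rfl, rfl⟩
  · -- `Z ≤ 1`
    have h1 : (zdPartitionFunction ρ β (halfOpenBox d n)).toReal ≤ 1 := by
      simpa using ENNReal.toReal_mono ENNReal.one_ne_top (hZ1 n β hβ)
    exact Real.log_nonpos ENNReal.toReal_nonneg h1
  · -- antitone
    have htop : zdPartitionFunction ρ β (halfOpenBox d n) ≠ ∞ :=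
      ne_top_of_le_ne_top ENNReal.one_ne_top (hZ1 n β hβ)
    exact Real.log_le_log (zdPartitionFunction_toReal_pos ρ hρ β n')
      (ENNReal.toReal_mono htop (zdPartitionFunction_anti ρ hρ hU hβ hnn'))
  · -- Theorem 7.1 in logarithmic form
    have hβ0 : (0 : ℝ) ≤ β := by linarith
    have htop : zdPartitionFunction ρ β (halfOpenBox d n) ≠ ∞ :=
      ne_top_of_le_ne_top ENNReal.one_ne_top (hZ1 n β hβ0)
    have h1 : Real.exp (-(C * n ^ d * Real.log β)) ≤ (zdPartitionFunction ρ β (halfOpenBox d n)).toReal := by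
      have := (ENNReal.toReal_le_toReal ENNReal.ofReal_ne_top htop).2 (h71 n β hβ)
      rwa [ENNReal.toReal_ofReal (Real.exp_pos _).le] at this
    rw [← Real.log_exp (-(C * (n : ℝ) ^ d * Real.log β))]
    exact Real.log_le_log (Real.exp_pos _) h1
  · -- Lemma 17.5
    have := ChatterjeeFreeEnergy.le_log_Z_mul (d := d) ρ hρ hM β n k
    rwa [abs_of_nonneg hβ] at this

end Compose

/-- **The crux from the stubs.** For a compact simple `G` (only compactness and the faithful unitary
representation `r` are used) the one-box interface of `r.ρ` in the exponential chart
(`exists_oneBoxBounds`), the abstract joint limit (stub 1) with Theorem 15.2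
(`LatticeMaxwell.tendsto_logZM_div`), and the transfer to the torus (stub 7) give
`f_r(β) + (3D/2) log β → K_r`. [cite: arXiv160201222, Thm. 2.1] -/
theorem FreeEnergyLogCoefficient_of :
    Summit.QuantumFields.YangMills.Theses.EquipartitionCriticality.FreeEnergyLogCoefficient := by
  intro G _ _ _ _ hG
  letI : MeasurableSpace G := borel G
  haveI : BorelSpace G := ⟨rfl⟩
  intro r
  haveI : SecondCountableTopology (Matrix (Fin r.N) (Fin r.N) ℂ) :=
    inferInstanceAs (SecondCountableTopology (Fin r.N → Fin r.N → ℂ))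
  haveI : SecondCountableTopology G :=
    (r.continuous.isClosedEmbedding r.injective).isEmbedding.secondCountableTopology
  obtain ⟨B, hBlog, hBD⟩ :=
    exists_oneBoxBounds (d := 4) r.ρ (by norm_num) r.continuous r.injective r.mem_unitary
  obtain ⟨L, hL⟩ := LatticeMaxwell.tendsto_logZM_div (d := 4) (by norm_num)
  have hjoint := stub_abstractJointLimit (d := 4) (by norm_num) B hL
  have hdim : dimE r.ρ = Module.finrank ℝ ↥(repLieAlgebra r) :=
    (stub_expChartPackage r.ρ r.continuous r.injective r.mem_unitary).2.2.2.1
  have hjoint' : Tendsto (fun p : ℕ × ℝ => freeEnergyPerSite r.ρ p.2 (halfOpenBox 4 p.1) +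
      (1 / 2) * ((4 : ℝ) - 1 - 4 / p.1 + 1 / (p.1 : ℝ) ^ 4) * (dimE r.ρ : ℝ) * Real.log p.2)
      (atTop ×ˢ atTop) (𝓝 ((((4 : ℕ) : ℝ) - 1) * Real.log B.cH + (B.D : ℝ) * L)) := by
    refine hjoint.congr' ?_
    have hev : ∀ᶠ p : ℕ × ℝ in atTop ×ˢ atTop, 1 ≤ p.1 := (eventually_ge_atTop 1).prod_inl _
    filter_upwards [hev] with p hp
    rw [OneBoxBounds.T, OneBoxBounds.F, hBlog, hBD, ChatterjeeJointLimit.coef_eq (by norm_num) hp,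
      ChatterjeeFreeEnergy.freeEnergyPerSite_halfOpenBox_eq]
    push_cast
    ring
  exact stub_transfer r hdim hjoint'

end Summit.QuantumFields.YangMills.Theorems.FreeEnergyLogCoefficient


namespace Summit.QuantumFields.YangMills.Theorems

/-- **Crux `FreeEnergyLogCoefficient` of route `EquipartitionCriticality`** (Chatterjee's Theorem 2.1 for
every compact group with a faithful unitary lattice representation, torus normalisation, `d = 4`):
`∀ G` compact simple Lie, `∀ r : LatticeRep G`, `∃ K`, `f_r(β) + (3D/2) log β → K`. [cite: arXiv160201222, Thm. 2.1] -/
theorem freeEnergyLogCoefficient_proof :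
    Summit.QuantumFields.YangMills.Theses.EquipartitionCriticality.FreeEnergyLogCoefficient :=
  FreeEnergyLogCoefficient.FreeEnergyLogCoefficient_of

end Summit.QuantumFields.YangMills.Theorems

end
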